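import Mathlib.Algebra.BigOperators.Fin
import Mathlib.Algebra.Field.Basic
import Mathlib.Data.List.OfFn
import Mathlib.Tactic.Ring
import Mathlib.Tactic.FieldSimp
import HarnessLib

/-!
# A nonzero kernel vector of a matrix given as a list of rows, by column elimination

Support file (linear algebra as a FUNCTIONAL PROGRAM on lists, for machine-level complexity
statements that must run Gaussian elimination, e.g. the unique decoder of one-point AG codes,
`Literature/InformationTheory/Coding/OnePointAGCodesDecoding.lean`, at the machine level). For a
field `K` with decidable equality:

* `dot u v = Σ uᵢ vᵢ` — the dot product of two lists (truncating `zipWith`);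
* `kerVec n rows : Option (List K)` — for a matrix given as a list of rows of length `n`, a NONZERO
  vector `v ∈ Kⁿ` with `row ⬝ v = 0` for every row, if one exists, else `none`. The program is the
  textbook elimination of the first column (structural recursion on `n`): if no row has a nonzero
  first entry, `e₀` is a kernel vector; otherwise pick the first such row `p`, subtract `(r₀/p₀) p`
  from every row `r`, drop the (now zero) first column, recurse on the remaining `n - 1` columns, and
  back-substitute the first coordinate `v₀ = -p₀⁻¹ (p.tail ⬝ v')`;
* its specification: `length_of_kerVec_eq_some` (`|v| = n`), `exists_ne_zero_of_kerVec_eq_some`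
  (`v ≠ 0`), `dot_eq_zero_of_kerVec_eq_some` (soundness: every row is orthogonal to `v`) and
  `isSome_kerVec` (completeness: if some nonzero `u ∈ Kⁿ` is orthogonal to all rows then the program
  succeeds), with the `Fin`-indexed corollaries `kerVec_ofFn_sound`, `isSome_kerVec_ofFn`.

Only `+, -, *, ⁻¹, = 0` of `K` and list primitives (`map`, `zipWith`, `find?`, `tail`, `sum`) are
used, each a bounded number (`O(m n²)`) of times, which is what a polynomial-time realisation on
codes needs (`Literature/Computability/Complexity/CodeFP.lean`); that realisation is not in this file.

## References

* D. E. Knuth, *The Art of Computer Programming*, Vol. 2, 3rd ed., Addison–Wesley 1998, §4.6.2,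
  Algorithm N ("Null space algorithm": vectors `v` with `vA = 0` by column operations /
  triangularisation, inside Berlekamp's factoring algorithm) — the program here is its recursive
  one-vector variant on rows; everything is proved in this file, the citation locates the method.
  Not held; cited for the algorithm only.
-/

namespace Literature.LinearAlgebra.Matrix.ListGauss

variable {K : Type*} [Field K]

/-! ### Dot product of lists -/

/-- The dot product of two lists, `dot [u₀,…] [v₀,…] = Σ uᵢ vᵢ` over the common indices (the
shorter list truncates the longer). [folklore] -/
def dot (u v : List K) : K := (List.zipWith (· * ·) u v).sum

/-- `dot [] v = 0`. [folklore] -/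
@[simp] theorem dot_nil_left (v : List K) : dot [] v = 0 := by simp [dot]

/-- `dot u [] = 0`. [folklore] -/
@[simp] theorem dot_nil_right (u : List K) : dot u [] = 0 := by simp [dot]

/-- `dot (a :: u) (b :: v) = a b + dot u v`. [folklore] -/
@[simp] theorem dot_cons_cons (a b : K) (u v : List K) : dot (a :: u) (b :: v) = a * b + dot u v := by
  simp [dot]

/-- Dotting with the zero vector gives `0`. [folklore] -/
theorem dot_replicate_zero (u : List K) (n : ℕ) : dot u (List.replicate n 0) = 0 := by
  induction u generalizing n with
  | nil => simp
  | cons a u ih => cases n <;> simp [List.replicate_succ, ih]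

/-- The zero vector dotted with anything gives `0`. [folklore] -/
theorem dot_replicate_zero_left (v : List K) (n : ℕ) : dot (List.replicate n 0) v = 0 := by
  induction v generalizing n with
  | nil => simp
  | cons a v ih => cases n <;> simp [List.replicate_succ, ih]

/-- Linearity of `dot` in the first argument along a row operation `r - c • p` (rows of equal
length). [folklore] -/
theorem dot_zipWith_sub_mul (c : K) : ∀ (r p v : List K), r.length = p.length →
    dot (List.zipWith (fun a b => a - c * b) r p) v = dot r v - c * dot p v
  | [], [], v, _ => by simp
  | a :: r, b :: p, [], _ => by simp
  | a :: r, b :: p, x :: v, h => by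
    have h' : r.length = p.length := by simpa using h
    rw [List.zipWith_cons_cons, dot_cons_cons, dot_cons_cons, dot_cons_cons,
      dot_zipWith_sub_mul c r p v h']
    ring
  | [], _ :: _, _, h => by simp at h
  | _ :: _, [], _, h => by simp at h

/-- `dot` of two `List.ofFn`s is the `Fin`-indexed sum `Σ fᵢ gᵢ`. [folklore] -/
theorem dot_ofFn {n : ℕ} (f g : Fin n → K) : dot (List.ofFn f) (List.ofFn g) = ∑ i, f i * g i := by
  induction n with
  | zero => simp
  | succ n ih => rw [List.ofFn_succ, List.ofFn_succ, dot_cons_cons, ih, Fin.sum_univ_succ]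

/-- `dot` with a list read back through `getD`: for `|v| = n`, `dot (ofFn f) v = Σ fᵢ v[i]`. [folklore] -/
theorem dot_ofFn_left {n : ℕ} (f : Fin n → K) (v : List K) (hv : v.length = n) :
    dot (List.ofFn f) v = ∑ i : Fin n, f i * v.getD i 0 := by
  have : v = List.ofFn fun i : Fin n => v.getD i 0 := by
    subst hv
    refine List.ext_getElem (by simp) fun i h₁ h₂ => ?_
    simp only [List.getElem_ofFn, List.getD_eq_getElem?_getD]
    rw [List.getElem?_eq_getElem h₁, Option.getD_some]
  conv_lhs => rw [this]
  exact dot_ofFn f _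

/-! ### The program -/

variable [DecidableEq K]

/-- One elimination step on the rows: subtract `(r₀/p₀) • p` from each row `r` and drop the first
column. [cite: KnuthTAOCP2, §4.6.2, Algorithm N] -/
def elimRows (p : List K) (rows : List (List K)) : List (List K) :=
  rows.map fun r => (List.zipWith (fun a b => a - r.headD 0 * (p.headD 0)⁻¹ * b) r p).tail

/-- **A nonzero kernel vector by column elimination.** `kerVec n rows`: for rows of length `n`,
`some v` with `v ∈ Kⁿ ∖ {0}` orthogonal to every row when such a vector exists, `none` otherwise
(`dot_eq_zero_of_kerVec_eq_some`, `isSome_kerVec`). [cite: KnuthTAOCP2, §4.6.2, Algorithm N] -/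
def kerVec : ℕ → List (List K) → Option (List K)
  | 0, _ => none
  | n + 1, rows =>
    match rows.find? (fun r => decide (r.headD 0 ≠ 0)) with
    | none => some (1 :: List.replicate n 0)
    | some p => (kerVec n (elimRows p rows)).map fun v => (-((p.headD 0)⁻¹ * dot p.tail v)) :: v

/-- The program on `0` columns finds nothing (there is no nonzero vector in `K⁰`). [folklore] -/
@[simp] theorem kerVec_zero (rows : List (List K)) : kerVec 0 rows = none := rfl

/-- Unfolding one step of the program. [folklore] -/
theorem kerVec_succ (n : ℕ) (rows : List (List K)) : kerVec (n + 1) rows =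
    match rows.find? (fun r => decide (r.headD 0 ≠ 0)) with
    | none => some (1 :: List.replicate n 0)
    | some p => (kerVec n (elimRows p rows)).map fun v => (-((p.headD 0)⁻¹ * dot p.tail v)) :: v :=
  rfl

omit [DecidableEq K] in
/-- Rows of length `n + 1` become rows of length `n` after one elimination step. [folklore] -/
theorem length_of_mem_elimRows {n : ℕ} {p : List K} (hp : p.length = n + 1) {rows : List (List K)}
    (hrows : ∀ r ∈ rows, r.length = n + 1) {r' : List K} (hr' : r' ∈ elimRows p rows) :
    r'.length = n := by
  obtain ⟨r, hr, rfl⟩ := List.mem_map.1 hr'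
  simp [List.length_zipWith, hrows r hr, hp]

/-! ### Specification -/

/-- The output has length `n`. [folklore] -/
theorem length_of_kerVec_eq_some : ∀ (n : ℕ) (rows : List (List K)) (v : List K),
    kerVec n rows = some v → v.length = n
  | 0, rows, v, h => by simp at h
  | n + 1, rows, v, h => by
    rw [kerVec_succ] at h
    split at h
    · cases h; simp
    · obtain ⟨v', hv', rfl⟩ := Option.map_eq_some_iff.1 h
      simp [length_of_kerVec_eq_some n _ v' hv']

/-- The output is not the zero vector: some entry is nonzero. [folklore] -/
theorem exists_ne_zero_of_kerVec_eq_some : ∀ (n : ℕ) (rows : List (List K)) (v : List K),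
    kerVec n rows = some v → ∃ x ∈ v, x ≠ 0
  | 0, rows, v, h => by simp at h
  | n + 1, rows, v, h => by
    rw [kerVec_succ] at h
    split at h
    · cases h; exact ⟨1, by simp, one_ne_zero⟩
    · obtain ⟨v', hv', rfl⟩ := Option.map_eq_some_iff.1 h
      obtain ⟨x, hx, hx0⟩ := exists_ne_zero_of_kerVec_eq_some n _ v' hv'
      exact ⟨x, List.mem_cons_of_mem _ hx, hx0⟩

omit [DecidableEq K] in
/-- A list with a nonzero entry is not a `replicate _ 0`. [folklore] -/
theorem ne_replicate_of_exists_ne_zero {v : List K} (h : ∃ x ∈ v, x ≠ 0) (n : ℕ) :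
    v ≠ List.replicate n 0 := by
  rintro rfl
  obtain ⟨x, hx, hx0⟩ := h
  exact hx0 (List.eq_of_mem_replicate hx)

/-- **Soundness**: every row (of length `n`) is orthogonal to the output.
[cite: KnuthTAOCP2, §4.6.2, Algorithm N] -/
theorem dot_eq_zero_of_kerVec_eq_some : ∀ (n : ℕ) (rows : List (List K)),
    (∀ r ∈ rows, r.length = n) → ∀ v : List K, kerVec n rows = some v → ∀ r ∈ rows, dot r v = 0
  | 0, rows, _, v, h, _, _ => by simp at h
  | n + 1, rows, hrows, v, h, r, hr => by
    rw [kerVec_succ] at h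
    split at h
    · rename_i hnone
      cases h
      have hr0 : r.headD 0 = 0 := by simpa using List.find?_eq_none.1 hnone r hr
      obtain _ | ⟨a, t⟩ := r
      · simp
      · simp only [List.headD_cons] at hr0
        subst hr0
        rw [dot_cons_cons, dot_replicate_zero]; ring
    · rename_i p hp
      obtain ⟨v', hv', rfl⟩ := Option.map_eq_some_iff.1 h
      have hpmem : p ∈ rows := List.mem_of_find?_eq_some hp
      have hp0 : p.headD 0 ≠ 0 := by simpa using List.find?_some hp
      have hplen : p.length = n + 1 := hrows p hpmem
      have ih := dot_eq_zero_of_kerVec_eq_some n (elimRows p rows)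
        (fun r' hr' => length_of_mem_elimRows hplen hrows hr') v' hv'
      obtain _ | ⟨b, pt⟩ := p
      · simp at hplen
      obtain _ | ⟨a, rt⟩ := r
      · have := hrows _ hr; simp at this
      simp only [List.headD_cons, List.tail_cons] at hp0 ih ⊢
      have hlen : rt.length = pt.length := by
        have h1 := hrows _ hr; have h2 := hplen
        simp only [List.length_cons, Nat.add_right_cancel_iff] at h1 h2
        rw [h1, h2]
      -- the eliminated row `r' = rt - (a/b) pt` is orthogonal to `v'`
      have hr' : (List.zipWith (fun x y => x - a * b⁻¹ * y) rt pt) ∈ elimRows (b :: pt) rows := by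
        refine List.mem_map.2 ⟨a :: rt, hr, ?_⟩
        simp
      have h0 := ih _ hr'
      rw [dot_zipWith_sub_mul _ _ _ _ hlen] at h0
      rw [dot_cons_cons]
      have : dot rt v' = a * b⁻¹ * dot pt v' := by rw [← sub_eq_zero]; exact h0
      rw [this]
      field_simp
      ring

/-- **Completeness**: if some nonzero `u ∈ Kⁿ` is orthogonal to all rows (of length `n`), the
program succeeds. [cite: KnuthTAOCP2, §4.6.2, Algorithm N] -/
theorem isSome_kerVec : ∀ (n : ℕ) (rows : List (List K)), (∀ r ∈ rows, r.length = n) →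
    ∀ u : List K, u.length = n → (∃ x ∈ u, x ≠ 0) → (∀ r ∈ rows, dot r u = 0) →
    (kerVec n rows).isSome = true
  | 0, rows, _, u, hu, hne, _ => by
    obtain ⟨x, hx, -⟩ := hne
    rw [List.length_eq_zero_iff.1 hu] at hx
    simp at hx
  | n + 1, rows, hrows, u, hu, hne, horth => by
    rw [kerVec_succ]
    split
    · rfl
    · rename_i p hp
      have hpmem : p ∈ rows := List.mem_of_find?_eq_some hp
      have hp0 : p.headD 0 ≠ 0 := by simpa using List.find?_some hp
      have hplen : p.length = n + 1 := hrows p hpmem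
      obtain _ | ⟨b, pt⟩ := p
      · simp at hplen
      obtain _ | ⟨u0, ut⟩ := u
      · simp at hu
      simp only [List.headD_cons] at hp0
      have hutlen : ut.length = n := by simpa using hu
      have hptlen : pt.length = n := by simpa using hplen
      have hpu : b * u0 + dot pt ut = 0 := by rw [← dot_cons_cons]; exact horth _ hpmem
      -- `ut` is a nonzero kernel vector of the eliminated rows
      have hne' : ∃ x ∈ ut, x ≠ 0 := by
        by_contra hall
        push Not at hall
        have hut : ut = List.replicate n 0 := by
          rw [← hutlen]; exact List.eq_replicate_iff.2 ⟨rfl, fun x hx => hall x hx⟩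
        rw [hut, dot_replicate_zero, add_zero] at hpu
        have hu0 : u0 = 0 := by
          rcases mul_eq_zero.1 hpu with h | h
          · exact absurd h hp0
          · exact h
        obtain ⟨x, hx, hx0⟩ := hne
        rcases List.mem_cons.1 hx with rfl | hx
        · exact hx0 hu0
        · exact hx0 (hall x hx)
      have horth' : ∀ r' ∈ elimRows (b :: pt) rows, dot r' ut = 0 := by
        intro r' hr'
        obtain ⟨r, hr, rfl⟩ := List.mem_map.1 hr'
        obtain _ | ⟨a, rt⟩ := r
        · have := hrows _ hr; simp at this
        have hrtlen : rt.length = pt.length := by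
          have := hrows _ hr; simp only [List.length_cons, Nat.add_right_cancel_iff] at this
          rw [this, hptlen]
        have hru : a * u0 + dot rt ut = 0 := by rw [← dot_cons_cons]; exact horth _ hr
        simp only [List.headD_cons, List.zipWith_cons_cons, List.tail_cons]
        rw [dot_zipWith_sub_mul _ _ _ _ hrtlen]
        have e1 : dot rt ut = -(a * u0) := by rw [← sub_eq_zero]; simpa [sub_neg_eq_add, add_comm] using hru
        have e2 : dot pt ut = -(b * u0) := by rw [← sub_eq_zero]; simpa [sub_neg_eq_add, add_comm] using hpu
        rw [e1, e2]
        field_simp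
        ring
      have ih := isSome_kerVec n (elimRows (b :: pt) rows)
        (fun r' hr' => length_of_mem_elimRows hplen hrows hr') ut hutlen hne' horth'
      simpa using ih

/-! ### `Fin`-indexed corollaries -/

omit [DecidableEq K] in
/-- Reading a list of length `n` back as `List.ofFn` of its entries. [folklore] -/
theorem ofFn_getD_eq {n : ℕ} (v : List K) (hv : v.length = n) :
    (List.ofFn fun i : Fin n => v.getD i 0) = v := by
  subst hv
  refine List.ext_getElem (by simp) fun i h₁ h₂ => ?_
  simp only [List.getElem_ofFn, List.getD_eq_getElem?_getD]
  rw [List.getElem?_eq_getElem h₂, Option.getD_some]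

/-- **Soundness, matrix form.** For an `m × n` matrix `M` fed as the list of its rows, an output
`v` of `kerVec` read as the vector `j ↦ v[j]` is a nonzero solution of `M v = 0`.
[cite: KnuthTAOCP2, §4.6.2, Algorithm N] -/
theorem kerVec_ofFn_sound {m n : ℕ} (M : Fin m → Fin n → K) {v : List K}
    (h : kerVec n (List.ofFn fun i => List.ofFn (M i)) = some v) :
    v.length = n ∧ (fun j : Fin n => v.getD j 0) ≠ 0 ∧ ∀ i, ∑ j, M i j * v.getD j 0 = 0 := by
  have hlen := length_of_kerVec_eq_some _ _ _ h
  refine ⟨hlen, fun h0 => ?_, fun i => ?_⟩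
  · obtain ⟨x, hx, hx0⟩ := exists_ne_zero_of_kerVec_eq_some _ _ _ h
    obtain ⟨k, hk, rfl⟩ := List.getElem_of_mem hx
    have := congr_fun h0 ⟨k, hlen ▸ hk⟩
    simp only [Pi.zero_apply, List.getD_eq_getElem?_getD, List.getElem?_eq_getElem hk,
      Option.getD_some] at this
    exact hx0 this
  · have hrow : List.ofFn (M i) ∈ List.ofFn fun i => List.ofFn (M i) :=
      List.mem_ofFn.2 ⟨i, rfl⟩
    have := dot_eq_zero_of_kerVec_eq_some n _ (fun r hr => by
      obtain ⟨i', rfl⟩ := List.mem_ofFn.1 hr; simp) v h _ hrow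
    rwa [dot_ofFn_left _ _ hlen] at this

/-- **Completeness, matrix form.** If `M u = 0` for some `u ≠ 0` then `kerVec` succeeds on the
rows of `M`. [cite: KnuthTAOCP2, §4.6.2, Algorithm N] -/
theorem isSome_kerVec_ofFn {m n : ℕ} (M : Fin m → Fin n → K) (u : Fin n → K) (hu : u ≠ 0)
    (h : ∀ i, ∑ j, M i j * u j = 0) :
    (kerVec n (List.ofFn fun i => List.ofFn (M i))).isSome = true := by
  refine isSome_kerVec n _ (fun r hr => ?_) (List.ofFn u) (by simp) ?_ fun r hr => ?_
  · obtain ⟨i, rfl⟩ := List.mem_ofFn.1 hr; simp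
  · by_contra hall
    push Not at hall
    exact hu (funext fun j => hall (u j) (List.mem_ofFn.2 ⟨j, rfl⟩))
  · obtain ⟨i, rfl⟩ := List.mem_ofFn.1 hr
    rw [dot_ofFn]
    exact h i

end Literature.LinearAlgebra.Matrix.ListGauss
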